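import Summits.QuantumFields.BalabanUV.T4Continuum.Support.NE7PairwiseMonotone

/-!
# NE7LoewnerJensen — row NE7 (node U5), route «PAIR-CAUCHY» ∕ supplier LÖW (ROUTES-NE7.md §L2.2) and source HOM (§L1.1
# K2a): the three S-sized kernel items of LÖW-1 — (B1(i), d = 1) block averaging does NOT increase the Dirichlet energy
# (Jensen, constant exactly 1 — the sign behind P-HOM-1's positive quartic defect and P-LÖW-1's PSD increments),
# (B3) the 2×2 PSD minor bound on off-diagonal elements, (B2) polarised matrix elements of a monotone bounded family
# of quadratic forms have a null tail modulus

Cell `pub-balaban`, rung (B)+1 sub-cell t4, lineage `b2b-balaban-t4-ne7-p2` (CRUX PROVER NE7 #2 under the coordinator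
ruling «YM redirect», 2026-08-21; generation 49; route texts `HOME/t4/ROUTES-NE7.md` v1 §L2.2 B1–B3 (idea-2's hand-off
«t4-ne7-p2 ← route LÖW: (1) kernel-prove B1(i) … and B3's PSD off-diagonal + monotone-bounded lemmas (S each)»),
`HOME/t4/b2b-balaban-t4-ne7-p2/g49/ROUTE2-NE7-P2.md` v1.4 §2 T.5♭, `g49/HOM-JUNCTION-NE7-P2.md` v1 §2).  HONEST FRAMING
(page 1): FIXED FINITE T⁴, rung (B)+1 = existence AND uniqueness of the `ε = L^{−K} → 0` limit of unit-scale averaged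
expectations, CONDITIONAL on BetaPertH and the nine spine estimates (0/9 proved); NOT infinite volume, NOT a mass gap, NOT
the Clay problem.  NE7 is NOT PRINTED in [Balaban1984PropagatorsI]–[Balaban1989LargeFieldII] and NOT proved here.
Everything below is [folklore] (finite sums, Cauchy–Schwarz, monotone convergence); no definition, no cite tag, nothing
printed asserted, no `sorry`.

WHY.  Route LÖW (idea-2) turns PRINTED one-run, k-uniform bounds on Bałaban's effective Gaussian operators into two-depth
moduli WITHOUT a rate by «Jensen ⟹ Löwner-monotone in the depth; monotone + bounded ⟹ bounded variation».  Its three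
elementary inputs, kernel-checked here in their simplest honest form: (B1(i), d = 1, free boundary) for the plain block
average `(Qu)(c) = L⁻¹ Σ_{y<L} u(Lc + y)` of a scalar chain, the coarse Dirichlet energy (spacing `L`, weight `η^{d−2} =
L⁻¹`) of `Qu` is at most the fine Dirichlet energy of `u`:
  `L⁻¹ Σ_{c<N} ((Qu)(c+1) − (Qu)(c))² ≤ Σ_{x<L(N+1)} (u(x+1) − u(x))²`
(two Cauchy–Schwarz steps; each fine bond is used at most `L` times; constant EXACTLY 1) — the same sign as P-HOM-1's
positive-definite quartic defect symbol ((L²−1)∕12)(Σp_μ⁴ + |p|⁴) (averaging lowers the quadratic action at low momentum)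
and as balaban-calc G13a's `ε†d(p)ε ≥ 0`; (B3) if `a s² + 2b st + c t² ≥ 0` for all real `s, t` then `|b| ≤ (a + c)∕2`
(the 2×2 minors of a PSD increment `D_k = C̃^{(k)} − C̃^{(k+1)}` dominate its off-diagonal entries by half-diagonals);
(B2) for a family of quadratic forms nondecreasing in the depth and bounded, every POLARISED matrix element
`¼(q_k(x+y) − q_k(x−y))` is a difference of two monotone bounded sequences, hence has a NULL TAIL MODULUS
(`NE7PairwiseMonotone.nullTail_of_monotone_bddAbove` twice) — the currency consumed by `NE7PairwiseScaleShift.nullShift_of_split`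
and by the pairwise exits.  Nothing here touches Bałaban's operators: the instantiation (Δ^{(k)} monotone in k at frozen
constraint constant, printed bound γ₀) is LÖW's B1(ii)∕(iii) for CMP 95's 1-forms with axial gauge — NOT done here.

WHAT IS PROVED ([folklore]).
§1 `sum_range_telescope_shift`, `blockAvg_diff_eq` (the coarse difference as a double sum of fine differences),
   `sum_blocks_eq` (`Σ_{c<N} Σ_{y<L} h(Lc+y) = Σ_{z<LN} h z`), `sum_shift_le` , **`jensen_blockAvg_dim1`** (displayed).
§2 **`abs_le_half_add_of_psd2`** (B3's 2×2 minor bound).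
§3 **`nullTail_of_polarised_monotone`** (B2: polarised elements of a monotone bounded family have a null tail modulus).

NOT DELIVERED: B1(ii)∕(iii) (abelian 1-forms with CMP 95's axial δ's; the hard∕soft-constraint forms Δ^{(k)}), the
diagram-BV lemma, LÖW-res.  NOT NE7 (spine 0/9 unchanged), NOT summit progress.  HONEST DEPENDENCY: continuum YM on T⁴ ⇐
BetaPertH ∧ nine spine estimates (0/9 proved); BetaPertH ⇐ (D1) ∧ (D4) ∧ CAP+tail; G-an2-4 gates asym, D1 and NE2/3/4.
-/

noncomputable section

open Finset Filter Topology
open scoped BigOperators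

namespace Summit.QuantumFields.BalabanUV.T4Continuum.NE7LoewnerJensen

/-! ## §1 Jensen under block averaging, d = 1, free boundary -/

/-- Telescoping along a block: `Σ_{t<L} (u(a+t+1) − u(a+t)) = u(a+L) − u(a)`. [folklore] -/
theorem sum_range_telescope_shift (u : ℕ → ℝ) (a L : ℕ) :
    ∑ t ∈ range L, (u (a + t + 1) - u (a + t)) = u (a + L) - u a := by
  have h := Finset.sum_range_sub (fun t => u (a + t)) L
  simpa [Nat.add_assoc] using h

/-- The difference of consecutive block sums is a double sum of fine differences:
`Σ_{y<L} u(L(c+1)+y) − Σ_{y<L} u(Lc+y) = Σ_{y<L} Σ_{t<L} (u(Lc+y+t+1) − u(Lc+y+t))`. [folklore] -/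
theorem blockAvg_diff_eq (u : ℕ → ℝ) (L c : ℕ) :
    (∑ y ∈ range L, u (L * (c + 1) + y)) - (∑ y ∈ range L, u (L * c + y))
      = ∑ y ∈ range L, ∑ t ∈ range L, (u (L * c + y + t + 1) - u (L * c + y + t)) := by
  rw [← Finset.sum_sub_distrib]
  refine Finset.sum_congr rfl fun y _ => ?_
  rw [sum_range_telescope_shift u (L * c + y) L]
  congr 2
  ring

/-- Blocks tile the chain: `Σ_{c<N} Σ_{y<L} h(Lc + y) = Σ_{z<LN} h z`. [folklore] -/
theorem sum_blocks_eq (h : ℕ → ℝ) (L : ℕ) :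
    ∀ N, ∑ c ∈ range N, ∑ y ∈ range L, h (L * c + y) = ∑ z ∈ range (L * N), h z := by
  intro N
  induction N with
  | zero => simp
  | succ N ih =>
    rw [Finset.sum_range_succ, ih, Nat.mul_succ, Finset.sum_range_add]

/-- A shifted window of a nonnegative sequence is dominated by a longer initial segment: for `t ≤ L`,
`Σ_{z<M} g(z+t) ≤ Σ_{x<M+L} g x`. [folklore] -/
theorem sum_shift_le {g : ℕ → ℝ} (hg : ∀ x, 0 ≤ g x) {t L : ℕ} (ht : t ≤ L) (M : ℕ) :
    ∑ z ∈ range M, g (z + t) ≤ ∑ x ∈ range (M + L), g x := by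
  have e : ∑ x ∈ range (t + M), g x = ∑ x ∈ range t, g x + ∑ z ∈ range M, g (t + z) := Finset.sum_range_add g t M
  have h1 : ∑ z ∈ range M, g (z + t) = ∑ z ∈ range M, g (t + z) :=
    Finset.sum_congr rfl fun z _ => by rw [add_comm]
  have h2 : 0 ≤ ∑ x ∈ range t, g x := Finset.sum_nonneg fun x _ => hg x
  have h3 : ∑ x ∈ range (t + M), g x ≤ ∑ x ∈ range (M + L), g x :=
    Finset.sum_le_sum_of_subset_of_nonneg (range_mono (by omega)) fun x _ _ => hg x
  linarith

/-- **JENSEN UNDER BLOCK AVERAGING, d = 1 (LÖW B1(i); the K2a ∕ P-HOM-1 sign).**  For a scalar chain `u`, block length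
`L ≥ 1` and `N` coarse bonds, the coarse Dirichlet energy of the block average (spacing `L`, weight `L^{d−2} = L⁻¹`) is at
most the fine Dirichlet energy:
`L⁻¹ · Σ_{c<N} (L⁻¹Σ_{y<L} u(L(c+1)+y) − L⁻¹Σ_{y<L} u(Lc+y))² ≤ Σ_{x<L(N+1)} (u(x+1) − u(x))²`.
Proof: the coarse difference is `L⁻¹ ×` a sum of `L²` fine differences (`blockAvg_diff_eq`), Cauchy–Schwarz
(`sq_sum_le_card_mul_sum_sq`) gives `(coarse difference)² ≤ Σ_{y,t<L} (fine difference at Lc+y+t)²`, and each fine bond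
`x` occurs as `Lc + y + t` at most `L` times (`sum_blocks_eq` + `sum_shift_le`).  Constant exactly `1`. [folklore] -/
theorem jensen_blockAvg_dim1 (u : ℕ → ℝ) {L : ℕ} (hL : 0 < L) (N : ℕ) :
    (1 / (L : ℝ)) * ∑ c ∈ range N,
        ((1 / (L : ℝ)) * ∑ y ∈ range L, u (L * (c + 1) + y) - (1 / (L : ℝ)) * ∑ y ∈ range L, u (L * c + y)) ^ 2
      ≤ ∑ x ∈ range (L * (N + 1)), (u (x + 1) - u x) ^ 2 := by
  set g : ℕ → ℝ := fun x => (u (x + 1) - u x) ^ 2 with hg_def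
  have hg0 : ∀ x, 0 ≤ g x := fun x => sq_nonneg _
  have hLr : (0 : ℝ) < L := by exact_mod_cast hL
  -- Step 1: Cauchy–Schwarz on each coarse bond
  have step1 : ∀ c, ((1 / (L : ℝ)) * ∑ y ∈ range L, u (L * (c + 1) + y)
      - (1 / (L : ℝ)) * ∑ y ∈ range L, u (L * c + y)) ^ 2
      ≤ ∑ y ∈ range L, ∑ t ∈ range L, g (L * c + y + t) := by
    intro c
    rw [← mul_sub, blockAvg_diff_eq, ← Finset.sum_product']
    have hcs := sq_sum_le_card_mul_sum_sq (s := range L ×ˢ range L)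
      (f := fun p : ℕ × ℕ => u (L * c + p.1 + p.2 + 1) - u (L * c + p.1 + p.2))
    rw [Finset.card_product, Finset.card_range] at hcs
    have hL2 : ((L * L : ℕ) : ℝ) = (L : ℝ) * L := by push_cast; ring
    rw [hL2] at hcs
    rw [mul_pow, ← Finset.sum_product']
    calc (1 / (L : ℝ)) ^ 2 * (∑ p ∈ range L ×ˢ range L, (u (L * c + p.1 + p.2 + 1) - u (L * c + p.1 + p.2))) ^ 2
        ≤ (1 / (L : ℝ)) ^ 2 * ((L : ℝ) * L *
            ∑ p ∈ range L ×ˢ range L, (u (L * c + p.1 + p.2 + 1) - u (L * c + p.1 + p.2)) ^ 2) :=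
          mul_le_mul_of_nonneg_left hcs (by positivity)
      _ = ∑ p ∈ range L ×ˢ range L, (u (L * c + p.1 + p.2 + 1) - u (L * c + p.1 + p.2)) ^ 2 := by
          field_simp
      _ = ∑ p ∈ range L ×ˢ range L, g (L * c + p.1 + p.2) := rfl
  -- Step 2: each fine bond is used at most L times
  have step2 : ∑ c ∈ range N, ∑ y ∈ range L, ∑ t ∈ range L, g (L * c + y + t)
      ≤ (L : ℝ) * ∑ x ∈ range (L * (N + 1)), g x := by
    calc ∑ c ∈ range N, ∑ y ∈ range L, ∑ t ∈ range L, g (L * c + y + t)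
        = ∑ c ∈ range N, ∑ t ∈ range L, ∑ y ∈ range L, g (L * c + y + t) := by
          refine Finset.sum_congr rfl fun c _ => ?_
          exact Finset.sum_comm
      _ = ∑ t ∈ range L, ∑ c ∈ range N, ∑ y ∈ range L, g (L * c + y + t) := Finset.sum_comm
      _ = ∑ t ∈ range L, ∑ z ∈ range (L * N), g (z + t) := by
          refine Finset.sum_congr rfl fun t _ => ?_
          exact sum_blocks_eq (fun z => g (z + t)) L N
      _ ≤ ∑ t ∈ range L, ∑ x ∈ range (L * (N + 1)), g x := by
          refine Finset.sum_le_sum fun t ht => ?_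
          have ht' : t ≤ L := (mem_range.mp ht).le
          have := sum_shift_le hg0 ht' (L * N)
          rwa [show L * N + L = L * (N + 1) by ring] at this
      _ = (L : ℝ) * ∑ x ∈ range (L * (N + 1)), g x := by
          rw [Finset.sum_const, Finset.card_range, nsmul_eq_mul]
  -- combine
  calc (1 / (L : ℝ)) * ∑ c ∈ range N,
        ((1 / (L : ℝ)) * ∑ y ∈ range L, u (L * (c + 1) + y) - (1 / (L : ℝ)) * ∑ y ∈ range L, u (L * c + y)) ^ 2
      ≤ (1 / (L : ℝ)) * ∑ c ∈ range N, ∑ y ∈ range L, ∑ t ∈ range L, g (L * c + y + t) :=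
        mul_le_mul_of_nonneg_left (Finset.sum_le_sum fun c _ => step1 c) (by positivity)
    _ ≤ (1 / (L : ℝ)) * ((L : ℝ) * ∑ x ∈ range (L * (N + 1)), g x) :=
        mul_le_mul_of_nonneg_left step2 (by positivity)
    _ = ∑ x ∈ range (L * (N + 1)), g x := by field_simp

/-! ## §2 The 2×2 PSD minor bound (LÖW B3) -/

/-- **OFF-DIAGONAL DOMINATION BY HALF-DIAGONALS.**  If the real quadratic form `a s² + 2b st + c t²` is nonnegative for all
`s, t`, then `|b| ≤ (a + c)∕2` (evaluate at `(1, 1)` and `(1, −1)`).  Applied to a PSD increment `D_k` of a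
Löwner-monotone covariance tower: `|D_k(x,x′)| ≤ ½(D_k(x,x) + D_k(x′,x′))`, whose sum over `k` telescopes against the
printed diagonal bound. [folklore] -/
theorem abs_le_half_add_of_psd2 {a b c : ℝ} (h : ∀ s t : ℝ, 0 ≤ a * s ^ 2 + 2 * b * s * t + c * t ^ 2) :
    |b| ≤ (a + c) / 2 := by
  have h1 := h 1 1
  have h2 := h 1 (-1)
  rw [abs_le]
  constructor <;> nlinarith

/-! ## §3 Polarised matrix elements of a monotone bounded family (LÖW B2) -/

/-- **POLARISED ELEMENTS OF A MONOTONE BOUNDED FAMILY HAVE A NULL TAIL MODULUS.**  If `p` and `m` are nondecreasing real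
sequences bounded above (think `p k = q_k(x + y)`, `m k = q_k(x − y)` for quadratic forms `q_k` nondecreasing in the
Löwner order and bounded by `a‖·‖²`), then the polarised element `b k = (p k − m k)∕4` — a difference of two monotone
bounded sequences, hence of bounded variation — satisfies `∀ j ≥ k, |b j − b_∞| ≤ c k` with `c → 0`: the tail-modulus
currency of `NE7PairwiseScaleShift.nullShift_of_split`, produced with NO rate. [folklore] -/
theorem nullTail_of_polarised_monotone {p m : ℕ → ℝ} {Bp Bm : ℝ}
    (hp : Monotone p) (hBp : ∀ k, p k ≤ Bp) (hm : Monotone m) (hBm : ∀ k, m k ≤ Bm) :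
    ∃ binf : ℝ, ∃ c : ℕ → ℝ, (∀ k j, k ≤ j → |(p j - m j) / 4 - binf| ≤ c k) ∧ Tendsto c atTop (𝓝 0) := by
  obtain ⟨pinf, _, hpt, hpl⟩ := NE7PairwiseMonotone.nullTail_of_monotone_bddAbove hp hBp
  obtain ⟨minf, _, hmt, hml⟩ := NE7PairwiseMonotone.nullTail_of_monotone_bddAbove hm hBm
  refine ⟨(pinf - minf) / 4, fun k => ((pinf - p k) + (minf - m k)) / 4, ?_, ?_⟩
  · intro k j hkj
    have h1 := hpt k j hkj
    have h2 := hmt k j hkj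
    have e : (p j - m j) / 4 - (pinf - minf) / 4 = ((p j - pinf) - (m j - minf)) / 4 := by ring
    rw [e, abs_div, abs_of_pos (by norm_num : (0 : ℝ) < 4)]
    have h3 : |(p j - pinf) - (m j - minf)| ≤ |p j - pinf| + |m j - minf| := abs_sub _ _
    have h4 : |(p j - pinf) - (m j - minf)| ≤ (pinf - p k) + (minf - m k) := by linarith
    exact div_le_div_of_nonneg_right h4 (by norm_num)
  · have := (hpl.add hml).div_const 4
    simpa using this

end Summit.QuantumFields.BalabanUV.T4Continuum.NE7LoewnerJensen

end
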